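import Summits.ValiantsHypothesis.ValiantsHypothesis.Theses.ValuativeGCT
import Literature.NumberTheory.DiophantineGeometry.SchurWeylPlethysmKroneckerBoundProofs
import Literature.NumberTheory.DiophantineGeometry.SchurWeylPlethysmOrbitWeightsProofs

/-!
# Line `hwtopoly-range-in-truncation` — skeleton for crux `ValuativeGCT.ValuativeBound`
# (stmt-ValiantsHypothesis-12625, route-ValiantsHypothesis-ValuativeGCT)

**Idea.** The tree already contains the injective `ℂ`-linear map
`hwToPoly (detFormLex ℂ m) m λ* : HW_{λ*}(ℂ[Δ(det_m)]) ↪ ℂ[Mat_{m²}]`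
(`SchurWeylPlethysmKroneckerBoundProofs` §1: the generic orbit map `genericOrbitMap` descended to
`ℂ[Δ] = ℂ[Sym^m] ⧸ I(GL·det_m)` through `orbitVanishingIdeal_eq_ker_genericOrbitMap`), landing in the
very polynomial ring in which the route types the valuative truncation `T_U(λ)`, with the same variable
convention (`X (j,i)` ↔ entry `A j i`). Hence
`K_m(λ) = finrank HW = finrank (range hwToPoly) ≤ finrank T_U(λ)` as soon as `range hwToPoly ≤ T_U(λ)`,
and that inclusion is four memberships, one per conjunct of `T`:

* degree `m·δ` — tree lemma `isHomogeneous_orbitCoordToPoly` + `size_toMatIdx_dualOfPartition`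
  (glue, no stub; this is where the guard `lam.parts.card ≤ m*m` is consumed);
* Borel semi-invariance `G(g⁻¹A) = χ(g) G(A)` as a POLYNOMIAL identity — `stub_leftFunctoriality`
  (`ψ_g ∘ Φ = Φ ∘ coordSubst g`, the convention pin of the line) + tree
  `sub_mem_of_mk_mem_highestWeightSpace` + kernel = ideal (glue);
* invariance under the FULL End-stabiliser `A ↦ A·M`, `M·det = det`, singular `M` included —
  `stub_rightFunctoriality` (`φ_M ∘ Φ_f = Φ_{M·f}`, valid at every matrix, no "stabilisers are
  invertible" lemma needed);
* the valuative conjunct `Φ(F) ∈ I(L_U)^(δ(m−r))` — `stub_homogeneousLift` (a weight-`χ` class of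
  `ℂ[Δ_m f]` has a representative homogeneous of degree `δ` upstairs: torus-weight truncation, no
  complete reducibility) + `stub_generatorsToPower` (generators in `J` ⇒ degree-`δ` forms in `J^δ`)
  + `stub_coeffVanishingOrder`, which is the route's support item `CoeffVanishingOrder` (stmt-12628) BY
  NAME (the only `det`-specific input), with `J := I(L_U)^(m−r)` and `J^δ = I(L_U)^(δ(m−r))` (`pow_mul`).

Stubs 1–4 are stated in "rising-sea" generality (any form `f` over any linearly ordered finite variable
set `σ`, any infinite field `k`), which is the generality in which the tree's §1 lemmas are already
proved; `generalTransport` (= the card's Transfer `C⁺`, any ideal `J` containing the `Φ`-images of the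
coordinate functions) is PROVED here from stubs 1–4, and `ValuativeBound_of : ValuativeBound`
specialises it to `f = det_m`, `J = I(L_U)^(m−r)` (generator condition = stub 5) and runs the finrank glue
(`hwToPoly_injective`, `LinearMap.finrank_range_of_inj`, `Submodule.finrank_mono`;
`T ≤ Hom_{mδ} ≤ restrictTotalDegree` is finite-dimensional, so `finrank T` is never junk).

**Shape.** One theorem (`ValuativeBound_of`) concludes the crux BY NAME with no hypotheses; `sorry` occurs
only in the five `stub_*`; the stubs are invoked inside the sorry-free glue (stub statements are
∀-telescopes without a named head, so they are used, not listed as by-name hypotheses).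

**Disproof used** (cdisprove `Disproof.lean` on stmt-12625, 2026-08-15, per its evidence notes; the file
itself is not mounted in this seat): `valuativeBound_false_without_rank` — the rank bound enters only
through `stub_coeffVanishingOrder` (used in `ValuativeBound_of`); `valuativeBound_false_without_card` —
the guard `lam.parts.card ≤ m*m` is consumed by `size_toMatIdx_dualOfPartition` in `ValuativeBound_of`;
`not_valuativeBoundSharperThreshold` / `coeffVanishingOrder_false_with_exponent_succ` — no stub claims an
exponent above `m − r` per coefficient / `δ(m−r)` in total; `coeffVanishingOrder_false_with_columns` —
every statement uses the ROW convention `L_U = {A | ∀ j, (i ↦ A j i) ∈ U}` of the route file verbatim.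
No `Negative/` lemma has landed for this crux (nothing to import).
-/

namespace Summit.ValiantsHypothesis.ValiantsHypothesis.Cruxes.ValuativeBound.HwtopolyRangeInTruncation

open MvPolynomial
open scoped BigOperators
open Literature.NumberTheory.DiophantineGeometry
open Literature.Computability.AlgebraicComplexity
open Summit.ValiantsHypothesis.ValiantsHypothesis.Theses.ValuativeGCT

/-! ## The four stubs -/

/-- **Stub 1 — generic LEFT functoriality of the generic orbit map (convention pin of the line).**
For every `g ∈ GL_σ(k)` and every polynomial `F` on `Sym^m`, substituting `A ↦ g⁻¹A` into
`Φ(F) = (A ↦ F(A·f))` gives `Φ(g·F)` where `(g·F)(v) = F(g⁻¹·v)` is `coordSubst m g F`: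
`ψ_g (genericOrbitMap f m F) = genericOrbitMap f m (coordSubst m g F)` with `ψ_g : X(j,i) ↦ Σ_l (g⁻¹)_{jl} X(l,i)`
(exactly the substitution of the Borel clause of `T`). Why true: evaluate both sides at an arbitrary
matrix `A` — `eval_genericOrbitMap` (twice), `MvPolynomial.eval_bind₁`/`aeval` composition
(`eval_A ψ_g(X(j,i)) = (g⁻¹A)_{ji}`, `Matrix.mul_apply`), `aeval_formCoeff_coordSubst`, `linSubstRep_apply`,
`linSubst_mul`; then `MvPolynomial.funext` (`k` infinite). Size: S–M (~20 lines). -/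
theorem stub_leftFunctoriality {σ k : Type*} [Fintype σ] [LinearOrder σ] [Field k] [Infinite k]
    (f : MvPolynomial σ k) (m : ℕ) (g : Matrix.GeneralLinearGroup σ k)
    (F : MvPolynomial (DegIdx σ m) k) :
    aeval (R := k) (fun p : σ × σ => ∑ l : σ,
        ((g⁻¹ : Matrix.GeneralLinearGroup σ k) : Matrix σ σ k) p.1 l • X (l, p.2))
        (genericOrbitMap f m F) =
      genericOrbitMap f m (coordSubst m g F) := by
  sorry

/-- **Stub 2 — generic RIGHT functoriality of the generic orbit map (all matrices, singular included).**
For every matrix `M` (not necessarily invertible) and every `F`,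
`φ_M (genericOrbitMap f m F) = genericOrbitMap (M·f) m F` with `φ_M : X(j,i) ↦ Σ_l M_{li} X(j,l)`
(the substitution `A ↦ A·M` of the stabiliser clause of `T`). In particular `φ_M` fixes `Φ(F)` whenever
`linSubst M f = f`, for EVERY such `M` — which is how the `⨅` over all End-stabilisers in `T` is met without
any "stabilisers of `det` are invertible" lemma. Why true: at every matrix `A`,
`(φ_M Φ(F))(A) = Φ(F)(A·M) = F((A·M)·f) = F(A·(M·f))` by `eval_genericOrbitMap` and `linSubst_mul`;
`MvPolynomial.funext`. Size: S–M (~20 lines). -/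
theorem stub_rightFunctoriality {σ k : Type*} [Fintype σ] [LinearOrder σ] [Field k] [Infinite k]
    (f : MvPolynomial σ k) (m : ℕ) (M : Matrix σ σ k) (F : MvPolynomial (DegIdx σ m) k) :
    aeval (R := k) (fun p : σ × σ => ∑ l : σ, M l p.2 • X (p.1, l)) (genericOrbitMap f m F) =
      genericOrbitMap (linSubst σ k M f) m F := by
  sorry

/-- **Stub 3 — homogeneous lift of a highest-weight class (torus-weight truncation, no semisimplicity).**
For `m ≠ 0` over an infinite field, every class `x ∈ HW_χ(k[Δ_m f])` with `χ.size = -(m·D)` has a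
representative `F ∈ k[Sym^m]` homogeneous of degree `D`. Why true: for any representative `F₀`, the
part `F_χ = Σ_{monWeight s = χ} c_s X^s` satisfies `F₀ - F_χ ∈ I(GL·f)` (tree:
`sum_filter_monWeight_mem_orbitVanishingIdeal`, fed by `sub_mem_of_mk_mem_highestWeightSpace` on diagonal
`t`), and every monomial `s` of torus weight `χ` has `size (monWeight s) = -(m·deg s)` (`size_monWeight`),
so `deg s = D` as `m ≠ 0`; this is the argument of `finiteDimensional_highestWeightSpace_orbitCoordRep_holds`
(SchurWeylPlethysmOrbitWeightsProofs §2) with `restrictTotalDegree` sharpened to `IsHomogeneous`.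
Size: M (~50 lines). This is the stub that uses `NeZero m` of the crux. -/
theorem stub_homogeneousLift {σ k : Type*} [Fintype σ] [LinearOrder σ] [Field k] [Infinite k]
    (f : MvPolynomial σ k) {m : ℕ} (hm : m ≠ 0) {χ : Weight σ} {D : ℕ}
    (hsize : χ.size = -((m * D : ℕ) : ℤ))
    (x : highestWeightSpace (orbitCoordRep f m) χ) :
    ∃ F : MvPolynomial (DegIdx σ m) k, F.IsHomogeneous D ∧
      Ideal.Quotient.mk (orbitVanishingIdeal f m) F = (x : OrbitCoordRing f m) := by
  sorry

/-- **Stub 4 — generators to powers.** If an algebra homomorphism `φ` out of a polynomial ring sends every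
variable into an ideal `J`, it sends every form of degree `D` into `J ^ D`. Why true: monomial expansion,
`φ (c • X^s) = c • ∏ φ(X_i)^(s i) ∈ J^(Σ s i) = J^D` (`Ideal.pow_mem_pow`, `Ideal.mul_mem_mul`/`Ideal.prod_mem`,
`Submodule.smul_mem`, `Ideal.sum_mem`). Used with `φ = genericOrbitMap det_m m`, `J = I(L_U)^(m−r)` (whose
generator condition is literally `CoeffVanishingOrder`) and `D = δ`. Size: S–M (~25 lines). -/
theorem stub_generatorsToPower {ι R A : Type*} [CommSemiring R] [CommSemiring A] [Algebra R A]
    (φ : MvPolynomial ι R →ₐ[R] A) (J : Ideal A) (hφ : ∀ i : ι, φ (X i) ∈ J)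
    {F : MvPolynomial ι R} {D : ℕ} (hF : F.IsHomogeneous D) :
    φ F ∈ J ^ D := by
  sorry

/-- **Stub 5 — the valuative estimate** (the ONLY `det`-specific input of the line; it is the route's
support item `ValuativeGCT.CoeffVanishingOrder`, stmt-ValiantsHypothesis-12628, BY NAME, so a proof of
either closes both): if every matrix of the linear space `U` has rank `≤ r`, every `x`-coefficient `c_d(A)`
of `det(Σ_j x_j · row_j A)` lies in `I(L_U)^(m−r)`, `L_U = {A | every row of A lies in U}` (ROW
convention — the column variant is false, cdisprove `coeffVanishingOrder_false_with_columns`; the exponent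
`m − r` is attained, `coeffVanishingOrder_false_with_exponent_succ`). Why true: split `row_j A = π(row_j A) +
(1−π)(row_j A)` along a linear projection `π` ONTO `U`; the entries of the second part are linear forms
vanishing on `L_U`; expand `det` multilinearly in columns (`Matrix.det_apply'`/`Finset.prod_add`): a term
taking the `U`-part in a column set `S` lies in `I(L_U)^(m−|S|)` manifestly and vanishes identically for
`|S| > r` (pointwise: `> r` columns of one element of `U` are dependent; `MvPolynomial.funext` with free
columns). Refuter-checked TRUE ×3 with this convention (item notes 20:09Z/20:13Z/20:29Z, 2026-08-15);
reportedly formalised as Part A of the ideator's `ValuativeBoundProof.lean` (evidence on stmt-12625,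
22:43Z). Size: M (~150 lines; Lean cost is the `I(L)^t`-membership bookkeeping). Degenerate `r ≥ m`:
exponent `0`, trivial. -/
theorem stub_coeffVanishingOrder :
    Summit.ValiantsHypothesis.ValiantsHypothesis.Theses.ValuativeGCT.CoeffVanishingOrder := by
  sorry

/-! ## Glue (sorry-free): the Transfer `C⁺` and the crux -/

/-- `finrank` glue (BLMW template `finrank_highestWeightSpace_orbitCoordRep_le`): an injection whose range
lies in a submodule `T` of a finite-dimensional submodule `S` bounds the dimension of the source by
`finrank T` (no junk: `T` is finite-dimensional). -/
theorem finrank_le_of_range_le {K V W : Type*} [Field K] [AddCommGroup V] [Module K V]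
    [AddCommGroup W] [Module K W] (Γ : V →ₗ[K] W) (hΓ : Function.Injective Γ)
    {T S : Submodule K W} [FiniteDimensional K S] (hTS : T ≤ S) (h : LinearMap.range Γ ≤ T) :
    Module.finrank K V ≤ Module.finrank K T := by
  haveI : FiniteDimensional K T := Submodule.finiteDimensional_of_le hTS
  calc Module.finrank K V = Module.finrank K (LinearMap.range Γ) :=
        (LinearMap.finrank_range_of_inj hΓ).symm
    _ ≤ Module.finrank K T := Submodule.finrank_mono h

/-- **Transfer `C⁺` (generalTransport), proved from the four stubs.** For any form `f` on a linearly
ordered finite variable set `σ` over a field of characteristic zero, `m ≠ 0`, any weight `χ` of size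
`-(m·D)` and any ideal `J` of `k[Mat_σ]` containing the `Φ`-images of all coordinate functions `X_d`,
the image of `HW_χ(k[Δ_m f])` under `hwToPoly` lies in
`Hom_{m·D} ⊓ J^D ⊓ (⨅_{M·f = f} ker(φ_M − id)) ⊓ (⨅_{g ∈ B} ker(ψ_g − χ(g)·id))`
— the valuative truncation with `det`, `U`, `r` abstracted away. The crux is the specialisation
`f = det_m`, `J = I(L_U)^(m−r)`, `D = δ` (`ValuativeBound_of`). -/
theorem generalTransport {σ k : Type*} [Fintype σ] [LinearOrder σ] [Field k] [CharZero k]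
    (f : MvPolynomial σ k) {m : ℕ} (hm : m ≠ 0) (χ : Weight σ) {D : ℕ}
    (hsize : χ.size = -((m * D : ℕ) : ℤ))
    (J : Ideal (MvPolynomial (σ × σ) k)) (hJ : ∀ d : DegIdx σ m, genericOrbitMap f m (X d) ∈ J) :
    LinearMap.range (hwToPoly f m χ) ≤
      MvPolynomial.homogeneousSubmodule (σ × σ) k (m * D) ⊓ (J ^ D).restrictScalars k ⊓
        (⨅ (M : Matrix σ σ k) (_ : linSubst σ k M f = f),
          LinearMap.ker ((MvPolynomial.aeval (R := k) fun p : σ × σ =>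
              ∑ l : σ, M l p.2 • MvPolynomial.X (p.1, l)).toLinearMap -
            LinearMap.id (R := k) (M := MvPolynomial (σ × σ) k))) ⊓
        (⨅ (g : Matrix.GeneralLinearGroup σ k) (_ : IsUpperTriangular g),
          LinearMap.ker ((MvPolynomial.aeval (R := k) fun p : σ × σ =>
              ∑ l : σ, ((g⁻¹ : Matrix.GeneralLinearGroup σ k) : Matrix σ σ k) p.1 l •
                MvPolynomial.X (l, p.2)).toLinearMap -
            weightChar χ g • LinearMap.id (R := k) (M := MvPolynomial (σ × σ) k))) := by
  rintro _ ⟨x, rfl⟩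
  obtain ⟨F, hFhom, hFx⟩ := stub_homogeneousLift f hm hsize x
  have hx : Ideal.Quotient.mk (orbitVanishingIdeal f m) F ∈ highestWeightSpace (orbitCoordRep f m) χ := by
    rw [hFx]; exact x.2
  have hP : hwToPoly f m χ x = genericOrbitMap f m F := by
    rw [hwToPoly_apply, ← hFx, orbitCoordToPoly_mk]
  refine Submodule.mem_inf.mpr ⟨Submodule.mem_inf.mpr ⟨Submodule.mem_inf.mpr ⟨?_, ?_⟩, ?_⟩, ?_⟩
  · -- degree `m·D`: scalars `t·1 ∈ B` pin the degree (tree)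
    rw [hP, ← orbitCoordToPoly_mk]
    exact (mem_homogeneousSubmodule _ _).mpr (isHomogeneous_orbitCoordToPoly f m hx hsize)
  · -- valuative conjunct: homogeneous lift + generators to powers
    rw [Submodule.restrictScalars_mem, hP]
    exact stub_generatorsToPower (genericOrbitMap f m) J hJ hFhom
  · -- invariance under every End-stabiliser of `f`
    refine (Submodule.mem_iInf _).mpr fun M => (Submodule.mem_iInf _).mpr fun hM => ?_
    rw [LinearMap.mem_ker, LinearMap.sub_apply, LinearMap.id_apply, AlgHom.toLinearMap_apply,
      sub_eq_zero, hP]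
    have h := stub_rightFunctoriality f m M F
    rw [hM] at h
    exact h
  · -- Borel semi-invariance of weight `χ`, as a polynomial identity
    refine (Submodule.mem_iInf _).mpr fun g => (Submodule.mem_iInf _).mpr fun hg => ?_
    rw [LinearMap.mem_ker, LinearMap.sub_apply, LinearMap.smul_apply, LinearMap.id_apply,
      AlgHom.toLinearMap_apply, sub_eq_zero, hP, stub_leftFunctoriality f m g F]
    have hsub := sub_mem_of_mk_mem_highestWeightSpace f m hx hg
    rw [orbitVanishingIdeal_eq_ker_genericOrbitMap, RingHom.mem_ker] at hsub
    change genericOrbitMap f m (coordSubst m g F - weightChar χ g • F) = 0 at hsub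
    rwa [map_sub, map_smul, sub_eq_zero] at hsub

/-- **The crux from the line**: `K_m(λ) = finrank HW_{λ*}(ℂ[Δ(det_m)]) ≤ finrank T_U(λ)`.
Specialise `generalTransport` to `f = det_m`, `χ = λ*` (`size_toMatIdx_dualOfPartition`, consuming
`lam.parts.card ≤ m*m`), `J = I(L_U)^(m−r)` (its generator condition is `CoeffVanishingOrder` — stub 5 —
unfolded: `genericOrbitMap` is that `aeval`, `Matrix.mvPolynomialX = Matrix.of fun j i => X (j,i)` by `rfl`),
rewrite `(I^(m−r))^δ = I^(δ(m−r))`, and bound dimensions along the injection `hwToPoly`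
(`finrank_le_of_range_le` with `T ≤ Hom_{mδ} ≤ restrictTotalDegree`). Sorry-free given the five stubs. -/
theorem ValuativeBound_of : ValuativeBound := by
  intro m _ U r hU δ lam hlam χ T
  have hm : m ≠ 0 := NeZero.ne m
  have hsize : χ.size = -((m * δ : ℕ) : ℤ) := size_toMatIdx_dualOfPartition m lam hlam
  have hJ : ∀ d : DegIdx (MatIdx m) m, genericOrbitMap (detFormLex ℂ m) m (X d) ∈
      (MvPolynomial.vanishingIdeal ℂ
        {p : MatIdx m × MatIdx m → ℂ | ∀ j : MatIdx m, (fun i => p (j, i)) ∈ U}) ^ (m - r) :=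
    fun d => stub_coeffVanishingOrder m U r hU d
  have key := generalTransport (detFormLex ℂ m) hm χ hsize _ hJ
  rw [← pow_mul, Nat.mul_comm (m - r) δ] at key
  have hT : LinearMap.range (hwToPoly (detFormLex ℂ m) m χ) ≤ T := key
  have hTS : T ≤ MvPolynomial.restrictTotalDegree (MatIdx m × MatIdx m) ℂ (m * δ) := fun P hP =>
    (MvPolynomial.mem_restrictTotalDegree _ _ _).mpr
      ((mem_homogeneousSubmodule _ _).mp
        (Submodule.mem_inf.mp (Submodule.mem_inf.mp (Submodule.mem_inf.mp hP).1).1).1).totalDegree_le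
  exact finrank_le_of_range_le _ (hwToPoly_injective _ _ _) hTS hT

end Summit.ValiantsHypothesis.ValiantsHypothesis.Cruxes.ValuativeBound.HwtopolyRangeInTruncation
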